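import Summits.CriticalPhenomena.CardyFormulaZ2.Theses.CardyMagicRigidity

/-!
# Route CardyMagicRigidity — glue item `LoopLimitFromMagic`

The support item `LoopLimitFromMagic` (stmt-CriticalPhenomena-14171) of route
`route-CriticalPhenomena-CardyMagicRigidity` states

  `MagicFormulaZ2 → MagicFormulaT → NestingRigidity → LoopLimitZ2EqT`.

By definition `NestingRigidity` is
`(body of MagicFormulaZ2) → (body of MagicFormulaT) → (body of LoopLimitZ2EqT)`,
so the item is pure logic: apply the rigidity hypothesis to the two magic formulas.
No mathematical content lives here; it stays in the cruxes `NestingRigidity`,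
`MagicFormulaT` and the input fact `MagicFormulaZ2`.
-/

namespace Summit.CriticalPhenomena.CardyFormulaZ2.Theorems

open Summit.CriticalPhenomena.CardyFormulaZ2.Theses.CardyMagicRigidity

/-- The glue item `LoopLimitFromMagic` of route CardyMagicRigidity: the target
`LoopLimitZ2EqT` (full-plane loop universality ℤ² ~ 𝕋 in DKKMO's coupling distance) follows from
the magic formula on ℤ² (`MagicFormulaZ2`), the magic formula on 𝕋 (`MagicFormulaT`) and nesting
rigidity (`NestingRigidity`), because `NestingRigidity` unfolds to exactly
`MagicFormulaZ2 → MagicFormulaT → LoopLimitZ2EqT`. -/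
theorem loopLimitFromMagic_proof :
    Summit.CriticalPhenomena.CardyFormulaZ2.Theses.CardyMagicRigidity.LoopLimitFromMagic := by
  unfold LoopLimitFromMagic
  intro h2 h4 h3
  exact h3 h2 h4

end Summit.CriticalPhenomena.CardyFormulaZ2.Theorems
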